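import Literature.Probability.RandomPlanarGeometry.HexSAWSurfaceWallRenewalSecondGap
import HarnessLib

/-!
# Hexagonal-lattice SAWs at a surface: slack four — the four-down order returning to the wall: system and table

Wall-renewal blocks of the brick-wall (hexagonal) half-plane walk (`ipwb m`: irreducible positive wall bridges of
length `m`) at slack four, `m = 6k + 4` with `k` visits, with FOUR down steps come in five vertical orders
(`four_down_slack_four`, `…SlackFourFourDown`); four stay off the wall inside the block and are classified by
`…SlackFourFourDownHyp` / `…Systems` / `…IntTable*` / `…Ident*`. This module treats the fifth order,
`D D U U D D U U` — two hairpins with a wall run between them (`dduudduu4_runs`, `…SlackFourFourDownRunsReturn`): an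
initial wall run of `p` steps, vertical steps at the columns `c₀ = p, c₁, …, c₇` separated by seven runs of
`h₁, …, h₇` steps on the rows `−1, −2, −1, 0, −1, −2, −1`, a final wall run of `f` steps.

* `Dduudduu4Hyp k p f h₁ … h₇ c₁ … c₇` — the arithmetic constraint system of the order (a `structure … : Prop` with
  the field names of `Dddduuuu4Hyp` …): LEN, VIS on three wall pieces (`p + h4 + f = 2k`), PAR, positive runs,
  SIGNS, ROWS (runs 1, 3, 5, 7 on row `−1`, runs 2, 6 on row `−2`, and on the wall row the middle run against the
  initial and the final run), WALL, XRNG, and irreducibility as three shields — low, high, and `irrmid`: no cut at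
  an even column strictly inside the middle wall run.

* `wall_point_right_of_initial_run`, `four_down_shield_mid` — the two geometric inputs the order adds to those of
  `…SlackFourFourDownGeometry`: a later wall point lies right of the initial wall run (self-avoidance), and an
  even-time wall point inside run 4 is not a wall-renewal time only if some earlier step column exceeds it or some
  later one does not (`isWRen_of_profile`). Order-free statements over run data with column formulas only.

* `dduudduu4_int_table` — the system has exactly the solutions of family B5 (`s4j k a`,
  `…SlackFourFourDownFamiliesShallow`; `a = (p − 1)/2`, `1 ≤ a ≤ k − 2`): the signs are `L R R R L R R`,
  `h₁ + 2 = p = h₂ + 1`, `h₃ = h₇ = f = 1`, `p + h₄ + 1 = p + h₅ + 2 = p + h₆ + 1 = 2k` — the conjunction B5 of the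
  four-down systems census, verbatim the `hF` hypothesis of `dduudduu4_eq_s4j` (`…SlackFourFourDownReturnSystem`).

STATUS: lane lemmas of the a-idea-1 bridge/renewal lineage, car 100-0 «four-down wall return: system and table» —
the B5 branch of the classification of the four-down stratum of the slack-four row of the wall-renewal census
(FINDING-HEX-WALL-SLACK-FOUR-LAW: `12·#{#stepsD = 4} = (k−2)(2k⁴ − 7k³ + 4k² + 7k + 6)`; B5 contributes `k − 2`).
The derivation of the system from the geometry and the identification with `s4j` follow in
`…SlackFourFourDownReturnSystem`. OURS (elementary). CHECKED: an integer model with exactly these constraints has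
the `k − 2` solutions and no other for `k ≤ 7`; without `irrmid` it has `5, 57, 298` spurious solutions at
`k = 4, 5, 6` (reducible walks cut inside the middle run). Sources: the renewal / irreducible-bridge structure [MS]
Madras–Slade §4.2 (Definition 4.2.1, p. 90; remark before (4.2.21), p. 94), the brick-wall frame [EJ] Enting–Jensen
§7.4.2, Fig. 7.10 — neither contains this system.
-/

namespace Literature.Probability.RandomPlanarGeometry.SAW.HexBW.Wall

open Finset Filter Function
open Literature.Probability.LatticeModels Literature.Probability.Percolation SimpleGraph

variable {ω : ℕ → Site 2}

/-- **The constraint system of a `D D U U D D U U` block at slack four** (the profile that returns to the wall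
inside the block: rows `−1, −2, −1, 0, −1, −2, −1`, run 4 on the wall), in the initial wall run `p`, the final wall
run `f`, the body runs `h₁ … h₇` and the columns `c₁ … c₇` of the vertical steps 2, …, 8 (`c₇ + f` is the span):
length `6k + 4`, `k ≥ 2` visits on the three wall pieces (`p + h4 + f = 2k`, `f ≥ 1`), parities (`p` odd;
`h1 h3 h5 h7` odd, `h2 h4 h6` even), positive runs, the seven signs `cⱼ = cⱼ₋₁ ± hⱼ` (`c₀ = p`), separated column
intervals for the runs sharing a row (runs 1, 3, 5, 7 on row `−1`; runs 2, 6 on row `−2`; on the wall row the middle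
run against the initial and the final run), the block resurfacing right of its initial run, the range
`1 ≤ cⱼ ≤ c₇ + f`, and irreducibility as THREE shields (low, high, and no cut inside the middle wall run). Same
field names as `Dddduuuu4Hyp` … (`…SlackFourFourDownHyp`) plus `mid0`, `row48`, `irrmid`. OURS (bookkeeping: the
hypothesis list of `dduudduu4_int_table`).
[cite: MadrasSlade1993, §4.2, Definition 4.2.1 (p. 90), remark before (4.2.21) (p. 94)]
[cite: EntingJensen2009, §7.4.2, Fig. 7.10] -/
structure Dduudduu4Hyp (k p f h1 h2 h3 h4 h5 h6 h7 c1 c2 c3 c4 c5 c6 c7 : ℕ) : Prop where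
  /-- at least two visits (`k ≥ 2`) -/
  hk : 2 ≤ k
  /-- LEN: the two outer wall runs, the seven body runs (run 4 is the middle wall run) and the eight vertical steps
      make up `6k + 4` -/
  hlen : p + f + h1 + h2 + h3 + h4 + h5 + h6 + h7 + 8 = 6 * k + 4
  /-- VIS: `k` visits on three wall pieces — `⌊p/2⌋ + h4/2 + (f + 1)/2 = k` with `p` odd, `h4` even, `f` odd, i.e. `p
      + h4 + f = 2k` -/
  hvis : p + h4 + f = 2 * k
  /-- the final wall run is non-empty -/
  hf : 1 ≤ f
  /-- PAR: the first down step leaves the wall at an odd column -/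
  hpp : p % 2 = 1
  /-- PAR: run 1 joins two vertical steps of the same type (`D D`), so its length is odd -/
  hp1 : h1 % 2 = 1
  /-- PAR: run 2 joins two vertical steps of opposite types (`D U`), so its length is even -/
  hp2 : h2 % 2 = 0
  /-- PAR: run 3 joins two vertical steps of the same type (`U U`), so its length is odd -/
  hp3 : h3 % 2 = 1
  /-- PAR: run 4 joins two vertical steps of opposite types (`U D`), so its length is even -/
  hp4 : h4 % 2 = 0
  /-- PAR: run 5 joins two vertical steps of the same type (`D D`), so its length is odd -/
  hp5 : h5 % 2 = 1
  /-- PAR: run 6 joins two vertical steps of opposite types (`D U`), so its length is even -/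
  hp6 : h6 % 2 = 0
  /-- PAR: run 7 joins two vertical steps of the same type (`U U`), so its length is odd -/
  hp7 : h7 % 2 = 1
  /-- run 1 is non-empty -/
  hh1 : 1 ≤ h1
  /-- run 2 is non-empty -/
  hh2 : 1 ≤ h2
  /-- run 3 is non-empty -/
  hh3 : 1 ≤ h3
  /-- run 4 is non-empty -/
  hh4 : 1 ≤ h4
  /-- run 5 is non-empty -/
  hh5 : 1 ≤ h5
  /-- run 6 is non-empty -/
  hh6 : 1 ≤ h6
  /-- run 7 is non-empty -/
  hh7 : 1 ≤ h7
  /-- SIGN: run 1 goes rightward or leftward from column `p` to column `c1` -/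
  e1 : c1 = p + h1 ∨ c1 + h1 = p
  /-- SIGN: run 2 goes rightward or leftward from column `c1` to column `c2` -/
  e2 : c2 = c1 + h2 ∨ c2 + h2 = c1
  /-- SIGN: run 3 goes rightward or leftward from column `c2` to column `c3` -/
  e3 : c3 = c2 + h3 ∨ c3 + h3 = c2
  /-- SIGN: run 4 goes rightward or leftward from column `c3` to column `c4` -/
  e4 : c4 = c3 + h4 ∨ c4 + h4 = c3
  /-- SIGN: run 5 goes rightward or leftward from column `c4` to column `c5` -/
  e5 : c5 = c4 + h5 ∨ c5 + h5 = c4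
  /-- SIGN: run 6 goes rightward or leftward from column `c5` to column `c6` -/
  e6 : c6 = c5 + h6 ∨ c6 + h6 = c5
  /-- SIGN: run 7 goes rightward or leftward from column `c6` to column `c7` -/
  e7 : c7 = c6 + h7 ∨ c7 + h7 = c6
  /-- ROWS: runs 1 and 3 share row `−1` and occupy separated column intervals, in one of the two orders -/
  row13 : (p < c2 ∧ p < c3 ∧ c1 < c2 ∧ c1 < c3) ∨ (c2 < p ∧ c3 < p ∧ c2 < c1 ∧ c3 < c1)
  /-- ROWS: runs 1 and 5 share row `−1` and occupy separated column intervals, in one of the two orders -/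
  row15 : (p < c4 ∧ p < c5 ∧ c1 < c4 ∧ c1 < c5) ∨ (c4 < p ∧ c5 < p ∧ c4 < c1 ∧ c5 < c1)
  /-- ROWS: runs 1 and 7 share row `−1` and occupy separated column intervals, in one of the two orders -/
  row17 : (p < c6 ∧ p < c7 ∧ c1 < c6 ∧ c1 < c7) ∨ (c6 < p ∧ c7 < p ∧ c6 < c1 ∧ c7 < c1)
  /-- ROWS: runs 3 and 5 share row `−1` and occupy separated column intervals, in one of the two orders -/
  row35 : (c2 < c4 ∧ c2 < c5 ∧ c3 < c4 ∧ c3 < c5) ∨ (c4 < c2 ∧ c5 < c2 ∧ c4 < c3 ∧ c5 < c3)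
  /-- ROWS: runs 3 and 7 share row `−1` and occupy separated column intervals, in one of the two orders -/
  row37 : (c2 < c6 ∧ c2 < c7 ∧ c3 < c6 ∧ c3 < c7) ∨ (c6 < c2 ∧ c7 < c2 ∧ c6 < c3 ∧ c7 < c3)
  /-- ROWS: runs 5 and 7 share row `−1` and occupy separated column intervals, in one of the two orders -/
  row57 : (c4 < c6 ∧ c4 < c7 ∧ c5 < c6 ∧ c5 < c7) ∨ (c6 < c4 ∧ c7 < c4 ∧ c6 < c5 ∧ c7 < c5)
  /-- ROWS: runs 2 and 6 share row `−2` and occupy separated column intervals, in one of the two orders -/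
  row26 : (c1 < c5 ∧ c1 < c6 ∧ c2 < c5 ∧ c2 < c6) ∨ (c5 < c1 ∧ c6 < c1 ∧ c5 < c2 ∧ c6 < c2)
  /-- ROWS, wall row: the middle wall run (run 4) lies strictly right of the initial wall run -/
  mid0 : p + 1 ≤ c3 ∧ p + 1 ≤ c4
  /-- ROWS, wall row: the middle wall run and the final wall run `c7 … c7 + f` occupy separated column intervals -/
  row48 : (c3 < c7 ∧ c3 < c7 + f ∧ c4 < c7 ∧ c4 < c7 + f) ∨ (c7 < c3 ∧ c7 + f < c3 ∧ c7 < c4 ∧ c7 + f < c4)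
  /-- WALL: the block resurfaces for good strictly right of its initial wall run -/
  wall : p + 1 ≤ c7
  /-- XRNG: column `c1` is positive (the block stays right of the wall origin) -/
  x1 : 1 ≤ c1
  /-- XRNG: column `c2` is positive (the block stays right of the wall origin) -/
  x2 : 1 ≤ c2
  /-- XRNG: column `c3` is positive (the block stays right of the wall origin) -/
  x3 : 1 ≤ c3
  /-- XRNG: column `c4` is positive (the block stays right of the wall origin) -/
  x4 : 1 ≤ c4
  /-- XRNG: column `c5` is positive (the block stays right of the wall origin) -/
  x5 : 1 ≤ c5
  /-- XRNG: column `c6` is positive (the block stays right of the wall origin) -/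
  x6 : 1 ≤ c6
  /-- XRNG: column `c1` does not exceed the span `c₇ + f` -/
  X1 : c1 ≤ c7 + f
  /-- XRNG: column `c2` does not exceed the span `c₇ + f` -/
  X2 : c2 ≤ c7 + f
  /-- XRNG: column `c3` does not exceed the span `c₇ + f` -/
  X3 : c3 ≤ c7 + f
  /-- XRNG: column `c4` does not exceed the span `c₇ + f` -/
  X4 : c4 ≤ c7 + f
  /-- XRNG: column `c5` does not exceed the span `c₇ + f` -/
  X5 : c5 ≤ c7 + f
  /-- XRNG: column `c6` does not exceed the span `c₇ + f` -/
  X6 : c6 ≤ c7 + f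
  /-- IRR, low shield: the block cannot be cut after its first two columns -/
  irrlo : p ≤ 2 ∨ c1 ≤ 2 ∨ c2 ≤ 2 ∨ c3 ≤ 2 ∨ c4 ≤ 2 ∨ c5 ≤ 2 ∨ c6 ≤ 2 ∨ c7 ≤ 2
  /-- IRR, high shield: the block cannot be cut before its last two columns -/
  irrhi :
    f ≤ 2 ∨ c7 + f ≤ c1 + 1 ∨ c7 + f ≤ c2 + 1 ∨ c7 + f ≤ c3 + 1 ∨ c7 + f ≤ c4 + 1 ∨ c7 + f ≤ c5 + 1 ∨
      c7 + f ≤ c6 + 1 ∨ c7 + f ≤ p + 1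
  /-- IRR, middle shield: the block cannot be cut at an even column strictly inside its middle wall run — some
  earlier step column lies right of it or some later one at or left of it -/
  irrmid :
    ∀ x : ℕ, x % 2 = 0 → c3 + 1 ≤ x → x + 1 ≤ c4 →
      x < p ∨ x < c1 ∨ x < c2 ∨ x < c3 ∨ c4 ≤ x ∨ c5 ≤ x ∨ c6 ≤ x ∨ c7 ≤ x

/-- Two coordinates determine a site of `ℤ²` (plumbing). [folklore] -/
private theorem site_ext_d4m {p q : Site 2} (h0 : p 0 = q 0) (h1 : p 1 = q 1) : p = q := by
  funext i
  fin_cases i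
  · exact h0
  · exact h1

/-- **A later wall point lies right of the initial wall run.** For a self-avoiding `ω` on `[0, m]` whose columns are
positive after time `0`, with initial wall run `ω i = (i, 0)` (`i ≤ p`): a wall point `ω t = (x, 0)` at a time
`p < t ≤ m` has `x ≥ p + 1` (else it would be the point `ω x` of the initial run). Used for the two ends of the
middle wall run of a `D D U U D D U U` block. OURS (routine tool).
[cite: MadrasSlade1993, §4.2, Definition 4.2.1 (p. 90)] [cite: EntingJensen2009, §7.4.2, Fig. 7.10] -/
theorem wall_point_right_of_initial_run {m p t : ℕ}
    (hinj : Set.InjOn ω {i | i ≤ m}) (hpos : ∀ i, 1 ≤ i → i ≤ m → 0 < ω i 0) (hpt : p < t) (htm : t ≤ m)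
    (hR0 : ∀ i, i ≤ p → ω i 0 = i ∧ ω i 1 = 0) (hy : ω t 1 = 0) : (p : ℤ) + 1 ≤ ω t 0 := by
  by_contra hlt
  have hx := hpos t (by omega) htm
  obtain ⟨x, hx'⟩ := Int.eq_ofNat_of_zero_le hx.le
  have hxp : x ≤ p := by omega
  have heq : ω x = ω t := site_ext_d4m (by rw [(hR0 x hxp).1, hx']) (by rw [(hR0 x hxp).2, hy])
  have := hinj (show x ∈ {i | i ≤ m} by simp only [Set.mem_setOf_eq]; omega)
    (show t ∈ {i | i ≤ m} by simp only [Set.mem_setOf_eq]; omega) heq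
  omega

/-- **Shield inside a middle wall run** of a four-down block (wall run `0 … p`, seven monotone body runs of
velocities `eⱼ = ±1` between the vertical steps at times `p < t₂ < … < t₈`, final run along the wall): if run 4
passes through a wall point `ω t = (x, 0)` at an even time `t₄ < t ≤ t₅`, then some earlier step column (`p`,
`ω t₂ 0`, `ω t₃ 0`, `ω t₄ 0`) exceeds `x` or some later one (`ω t₅ 0`, …, `ω t₈ 0`) is at most `x` — else `t` would
be a wall-renewal time (`isWRen_of_profile`). The order `D D U U D D U U` is the one four-down order with such a
run; companion of `four_down_shield_low/high` (`…SlackFourFourDownGeometry`), same proof. OURS (routine tool).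
[cite: MadrasSlade1993, §4.2, Definition 4.2.1 (p. 90)] [cite: EntingJensen2009, §7.4.2, Fig. 7.10] -/
theorem four_down_shield_mid {m p t₂ t₃ t₄ t₅ t₆ t₇ t₈ : ℕ} {e₁ e₂ e₃ e₄ e₅ e₆ e₇ : ℤ}
    (hbr : ∀ i, 1 ≤ i → i ≤ m → ω 0 0 < ω i 0 ∧ ω i 0 ≤ ω m 0) (hirr : ∀ t, 1 ≤ t → t < m → ¬ IsWRen m ω t)
    (hR0 : ∀ i, i ≤ p → ω i 0 = i ∧ ω i 1 = 0) (he₁ : e₁ = 1 ∨ e₁ = -1) (he₂ : e₂ = 1 ∨ e₂ = -1)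
    (he₃ : e₃ = 1 ∨ e₃ = -1) (he₄ : e₄ = 1 ∨ e₄ = -1) (he₅ : e₅ = 1 ∨ e₅ = -1) (he₆ : e₆ = 1 ∨ e₆ = -1)
    (he₇ : e₇ = 1 ∨ e₇ = -1) (hrun1 : ∀ i, p + 1 ≤ i → i ≤ t₂ → ω i 0 = p + e₁ * ((i - (p + 1) : ℕ) : ℤ))
    (hrun2 : ∀ i, t₂ + 1 ≤ i → i ≤ t₃ → ω i 0 = ω t₂ 0 + e₂ * ((i - (t₂ + 1) : ℕ) : ℤ))
    (hrun3 : ∀ i, t₃ + 1 ≤ i → i ≤ t₄ → ω i 0 = ω t₃ 0 + e₃ * ((i - (t₃ + 1) : ℕ) : ℤ))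
    (hrun4 : ∀ i, t₄ + 1 ≤ i → i ≤ t₅ → ω i 0 = ω t₄ 0 + e₄ * ((i - (t₄ + 1) : ℕ) : ℤ))
    (hrun5 : ∀ i, t₅ + 1 ≤ i → i ≤ t₆ → ω i 0 = ω t₅ 0 + e₅ * ((i - (t₅ + 1) : ℕ) : ℤ))
    (hrun6 : ∀ i, t₆ + 1 ≤ i → i ≤ t₇ → ω i 0 = ω t₆ 0 + e₆ * ((i - (t₆ + 1) : ℕ) : ℤ))
    (hrun7 : ∀ i, t₇ + 1 ≤ i → i ≤ t₈ → ω i 0 = ω t₇ 0 + e₇ * ((i - (t₇ + 1) : ℕ) : ℤ))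
    (hR8 : ∀ j, t₈ + 1 ≤ j → j ≤ m → ω j 0 = ω t₈ 0 + ((j - (t₈ + 1) : ℕ) : ℤ) ∧ ω j 1 = 0) (hlt1 : p < t₂)
    (hlt2 : t₂ < t₃) (hlt3 : t₃ < t₄) (hlt4 : t₄ < t₅) (hlt5 : t₅ < t₆) (hlt6 : t₆ < t₇) (hlt7 : t₇ < t₈)
    (h8 : t₈ < m) {t : ℕ} (ht4 : t₄ + 1 ≤ t) (ht5 : t ≤ t₅) (hte : t % 2 = 0) (hty : ω t 1 = 0) :
    ω t 0 < p ∨ ω t 0 < ω t₂ 0 ∨ ω t 0 < ω t₃ 0 ∨ ω t 0 < ω t₄ 0 ∨ ω t₅ 0 ≤ ω t 0 ∨ ω t₆ 0 ≤ ω t 0 ∨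
      ω t₇ 0 ≤ ω t 0 ∨ ω t₈ 0 ≤ ω t 0 := by
  by_contra hcon
  simp only [not_or, not_lt, not_le] at hcon
  obtain ⟨hc0, hc1, hc2, hc3, hc4, hc5, hc6, hc7⟩ := hcon
  have hb1 := hrun1 t₂ (by omega) le_rfl
  have hb2 := hrun2 t₃ (by omega) le_rfl
  have hb3 := hrun3 t₄ (by omega) le_rfl
  have hb4 := hrun4 t₅ (by omega) le_rfl
  have hb5 := hrun5 t₆ (by omega) le_rfl
  have hb6 := hrun6 t₇ (by omega) le_rfl
  have hb7 := hrun7 t₈ (by omega) le_rfl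
  have hbt := hrun4 t ht4 ht5
  refine hirr t (by omega) (by omega) (isWRen_of_profile hbr (by omega) hte hty ?_ ?_)
  · intro i hi1 hi2
    rw [hbt]
    rcases Nat.lt_or_ge i (p + 1) with hj | hj
    · rw [(hR0 i (by omega)).1]; omega
    rcases Nat.lt_or_ge i (t₂ + 1) with hja | hja
    · have := hrun1 i hj (by omega); rcases he₁ with rfl | rfl <;> omega
    rcases Nat.lt_or_ge i (t₃ + 1) with hjb | hjb
    · have := hrun2 i hja (by omega); rcases he₂ with rfl | rfl <;> omega
    rcases Nat.lt_or_ge i (t₄ + 1) with hjc | hjc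
    · have := hrun3 i hjb (by omega); rcases he₃ with rfl | rfl <;> omega
    · have := hrun4 i hjc (by omega); rcases he₄ with rfl | rfl <;> omega
  · intro j hj1 hj2
    rw [hbt]
    rcases Nat.lt_or_ge j (t₅ + 1) with hjd | hjd
    · have := hrun4 j (by omega) (by omega); rcases he₄ with rfl | rfl <;> omega
    rcases Nat.lt_or_ge j (t₆ + 1) with hje | hje
    · have := hrun5 j hjd (by omega); rcases he₅ with rfl | rfl <;> omega
    rcases Nat.lt_or_ge j (t₇ + 1) with hjf | hjf
    · have := hrun6 j hje (by omega); rcases he₆ with rfl | rfl <;> omega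
    rcases Nat.lt_or_ge j (t₈ + 1) with hjg | hjg
    · have := hrun7 j hjf (by omega); rcases he₇ with rfl | rfl <;> omega
    · have := (hR8 j hjg hj2).1; omega

/-- **Integer table of the `D D U U D D U U` blocks.** The system `Dduudduu4Hyp` has exactly the solutions of family
B5 (`s4j k a` of `…SlackFourFourDownFamiliesShallow`, `a = (p − 1)/2`, `1 ≤ a ≤ k − 2`): signs `L R R R L R R`, the
first excursion `D D U U` is the hairpin `p → 2 → p + 1 → c₃ = p + 2` of runs `p − 2, p − 1, 1`, the middle wall run
has `h4 = 2k − 1 − p` steps, the second excursion is the hairpin `c₄ → c₃ + 1 → c₄ + 1 → c₄ + 2` of runs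
`h4 − 1, h4, 1`, and the final run is one step — stated as the conjunction B5 of the four-down systems census (the
`hF` hypothesis of `dduudduu4_eq_s4j`, `…SlackFourFourDownReturnSystem`). Proof: the wall-row separations force runs
2, 4, 6 rightward and put every pair of same-row runs in time order left to right; a leftward run 3 is cut by the
middle shield at column `c₂`, a rightward one forces `c₅ = c₃ + 1` by the middle shield at `c₃ + 1`; then the low
and high shields leave `c₁ = 2`, `f = 1` and the length count closes the table (each `omega` sees at most two
disjunctions). CHECKED: an integer model with exactly these constraints has the `k − 2` solutions `s4j k a` and no
other for `k ≤ 7`. OURS. [cite: MadrasSlade1993, §4.2, Definition 4.2.1 (p. 90), remark before (4.2.21) (p. 94)]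
[cite: EntingJensen2009, §7.4.2, Fig. 7.10] -/
theorem dduudduu4_int_table {k p f h1 h2 h3 h4 h5 h6 h7 c1 c2 c3 c4 c5 c6 c7 : ℕ}
    (H : Dduudduu4Hyp k p f h1 h2 h3 h4 h5 h6 h7 c1 c2 c3 c4 c5 c6 c7) :
    c1 + h1 = p ∧ c2 = c1 + h2 ∧ c3 = c2 + h3 ∧ c4 = c3 + h4 ∧ c5 + h5 = c4 ∧ c6 = c5 + h6 ∧ c7 = c6 + h7 ∧
      h1 + 2 = p ∧ h2 + 1 = p ∧ h3 = 1 ∧ p + h4 + 1 = 2 * k ∧ p + h5 + 2 = 2 * k ∧ p + h6 + 1 = 2 * k ∧ h7 = 1 ∧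
      f = 1 ∧ 3 ≤ p ∧ p + 3 ≤ 2 * k := by
  obtain
      ⟨hk, hlen, hvis, hf, hpp, hp1, hp2, hp3, hp4, hp5, hp6, hp7, hh1, hh2, hh3, hh4, hh5, hh6, hh7, e1, e2, e3, e4,
          e5,
    e6, e7, row13, row15, row17, row35, row37, row57, row26, mid0, row48, wall, x1, x2, x3, x4, x5, x6, X1, X2, X3,
        X4, X5,
    X6, lo, hi, mid⟩ := H
  -- the wall-row separations resolve every shared row left to right and force runs 2, 4, 6 rightward
  have r48 : c3 < c7 ∧ c4 < c7 := by clear * - row48 X4 hf; omega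
  have r13 : p < c2 ∧ p < c3 ∧ c1 < c2 ∧ c1 < c3 := by clear * - row13 mid0; omega
  have r15 : p < c4 ∧ p < c5 ∧ c1 < c4 ∧ c1 < c5 := by clear * - row15 mid0; omega
  have r17 : p < c6 ∧ p < c7 ∧ c1 < c6 ∧ c1 < c7 := by clear * - row17 wall; omega
  have E2 : c2 = c1 + h2 := by clear * - e2 r13 hh2; omega
  have E4 : c4 = c3 + h4 := by clear * - e4 row35 row26 r15 hh4; omega
  have r35 : c2 < c4 ∧ c2 < c5 ∧ c3 < c4 ∧ c3 < c5 := by clear * - row35 E4 hh4; omega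
  have r26 : c1 < c5 ∧ c1 < c6 ∧ c2 < c5 ∧ c2 < c6 := by clear * - row26 r15; omega
  have r37 : c2 < c6 ∧ c2 < c7 ∧ c3 < c6 ∧ c3 < c7 := by clear * - row37 r48; omega
  have r57 : c4 < c6 ∧ c4 < c7 ∧ c5 < c6 ∧ c5 < c7 := by clear * - row57 r48; omega
  have E6 : c6 = c5 + h6 := by clear * - e6 r57 hh6; omega
  clear row13 row15 row17 row35 row37 row57 row26 row48 e2 e4 e6
  -- parities of the columns `c₂`, `c₃` and of `f`
  have q1 : c1 % 2 = 0 := by clear * - e1 hpp hp1; omega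
  have q2 : c2 % 2 = 0 := by clear * - E2 q1 hp2; omega
  have q3 : c3 % 2 = 1 := by clear * - e3 q2 hp3; omega
  have qf : f % 2 = 1 := by clear * - hvis hpp hp4; omega
  rcases e3 with E3 | E3
  swap
  · -- run 3 leftward: the middle shield at the even column `c₂` of the middle wall run cuts the block
    exfalso
    rcases Nat.lt_or_ge c2 c4 with hx | hx
    · have M := mid c2 q2 (by clear * - E3 hh3; omega) (by clear * - hx; omega)
      clear * - M r13 E3 hh3 hx r35 r37
      omega
    · clear * - hx r35
      omega
  -- run 3 rightward: the middle shield at `c₃ + 1` forces the second excursion back to column `c₃ + 1`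
  have M := mid (c3 + 1) (by clear * - q3; omega) le_rfl (by clear * - E4 hh4 hp4; omega)
  have C5 : c5 = c3 + 1 := by
    clear * - M mid0 r13 E3 hh3 E4 hh4 hp4 r35 E6 hh6 r57
    omega
  clear M mid
  rcases e5 with E5 | E5
  · exfalso
    clear * - E5 C5 E4 hh4 hh5
    omega
  -- the shields: `c₁ = 2` (low), `f = 1` (high), and the length count closes the table
  have hi' : f ≤ 2 ∨ c7 + f ≤ c6 + 1 := by
    clear * - hi r17 r37 r57 hf
    omega
  clear hi
  rcases e1 with E1 | E1
  · exfalso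
    have lo' : p ≤ 2 := by
      clear * - lo E1 r13 r15 r17 hh1
      omega
    clear lo
    rcases e7 with E7 | E7
    · clear * - lo' hi' E7 hh7 qf hlen hvis E1 E2 E3 E4 C5 E5 E6 r13 r57 hh1 hh2 hh3 hp4 hp6
      omega
    · clear * - lo' hi' E7 hh7 qf hp7 X6 hlen hvis E1 E2 E3 E4 C5 E5 E6 r13 r57 hh1 hh2 hh3 hp4 hp6
      omega
  have lo' : c1 = 2 := by
    clear * - lo E1 r13 r15 r17 hh1 x1 q1 hpp
    omega
  clear lo
  rcases e7 with E7 | E7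
  swap
  · exfalso
    clear * - lo' hi' E7 hh7 qf hp7 X6 hlen hvis E1 E2 E3 E4 C5 E5 E6 r13 r57 hh1 hh2 hh3 hp4 hp6
    omega
  have F1 : f = 1 := by
    clear * - hi' E7 hh7 qf
    omega
  have K : h2 = h1 + 1 ∧ h3 = 1 ∧ h6 = h4 ∧ h7 = 1 := by
    clear * - lo' F1 hlen hvis E1 E2 E3 E4 C5 E5 E6 E7 r13 r57 hh3 hh7 hp2 hp1 hpp hp4 hp6
    omega
  have L : h1 + 2 = p ∧ h2 + 1 = p ∧ p + h4 + 1 = 2 * k ∧ p + h5 + 2 = 2 * k ∧ p + h6 + 1 = 2 * k ∧ 3 ≤ p ∧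
      p + 3 ≤ 2 * k := by
    clear * - K lo' F1 hvis E1 C5 E5 E4 hh1 hh5 hk
    omega
  exact
      ⟨by clear * - E1; omega, E2, E3, E4, E5, E6, E7, L.1, L.2.1, K.2.1, L.2.2.1, L.2.2.2.1, L.2.2.2.2.1, K.2.2.2,
          F1,
    L.2.2.2.2.2⟩

end Literature.Probability.RandomPlanarGeometry.SAW.HexBW.Wall
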